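import Summits.HodgeConjecture.CorCM.MultiFieldWeilNetTheoremAllKindsMeet
import HarnessLib

/-!
# MULTI-FIELD WEIL ENGINE — SHOWCASE: A DECIC FIELD OF `2`-TRANSITIVE KIND AND A DECIC FIELD OF DIHEDRAL KIND THROUGH `k` WITH `Hom = ∅` BETWEEN THEM — `E`, up to two
# `(2,3)`-fivefolds over each: the Hodge conjecture for every product of copies, given only Markman's fourfold and hyperbolic-sixfold theorems

Cell `pub-hodgecm2` (COR-CM), seat b30 gen 43 (2026-08-26); count-neutral own lane MULTI-FIELD WEIL ENGINE (stem `MultiFieldWeil*`), the two-DECIC-field instance of THE NET THEOREM OF ALL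
KINDS (`CorCM/MultiFieldWeilNetTheoremAllKindsMeet.lean`, `hodgeConjectureFor_biproduct_sigma_allKinds_of_shapes_meet`) written out with the hypotheses a reader needs and nothing
else (pattern of gen 41's `CorCM/MultiFieldWeilSexticImprimitiveOcticShowcase.lean`).  Theorems only; no definition, no named fact, no `sorry`.  HONEST FRAMING: conditional ONLY on
the two displayed Markman binders; `HC_CM` is NOT proved and not asserted.

**`hodgeConjectureFor_biproduct_twoKindsDecic`.**  `k` imaginary quadratic with `τ`, `E ⊨ (k; {τ})`; `K₅ ⊇ i₅(k)` a decic CM field with a DEGREE-`40` PAIR (two `τ`-embeddings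
`s₀ ≠ t₀` with `[ℚ(τk, s₀K₅, t₀K₅) : ℚ] = 40`: quintic part `2`-transitive) and structures `T t ⊨ (K₅; Ψ₅ t)` (`t : Fin c`, `c ≤ 2`), each with TWO type members over `τ`, pairwise
non-isogenous; `K₁₀ ⊇ i₁₀(k)` ANY decic CM field with Galois closure of degree `≤ 20` in `ℂ` and a `τ`-embedding
value outside the field generated by another (`K₁₀ = k·K₁₀⁺`, `K₁₀⁺` real quintic with DIHEDRAL Galois group), with structures `D t ⊨ (K₁₀; Ψ₁₀ t)` (`t : Fin c'`, `c' ≤ 2`), each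
with TWO type members over `τ` (`k`-signature `(2,3)`), pairwise non-isogenous, and — when two — `τ`-parts DIFFERENT and SHARING a `τ`-embedding.  BETWEEN the two fields ONLY `Hom(K₅, K₁₀) = Hom(K₁₀, K₅) = ∅`.  THEN the Hodge conjecture
holds for every product of copies `⨁_l X_l`, `X_l ∈ {E} ∪ {T t} ∪ {D t}` (+ dominated form), GIVEN ONLY Markman's two theorems (the fourfold binder is carried by the engine and idle
here).
[cite: Markman2025SurveySecant, Thm. 1.2] [cite: Markman2025SecantWeil, Thm 1.5.1] [cite: Shimura1998, §6.1 Corollary of Theorem 2, §8.2 Prop. 26, §18.2 Lemma (i)]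
[cite: Serre1977, §2.3 Ex. 2.6; §5.3] [cite: DixonMortimer1996, §1.4 Ex. 1.4.1–1.4.2; §1.6, Thm. 1.6A; §2.1; §3.3] [cite: Lang2002, VI §1 Thm. 1.1; XIII §4] [cite: MumfordAV1970, §19]

## References
* [Markman2025SurveySecant] E. Markman, arXiv:2509.23403, Thm. 1.2.  [Markman2025SecantWeil] E. Markman, Cycles on abelian 2n-folds of Weil type from secant sheaves on abelian
  n-folds, Thm 1.5.1.  [Shimura1998] G. Shimura, *Abelian varieties with complex multiplication and modular functions*, §6.1, §8.2, §18.2.  [Serre1977] J.-P. Serre, *Linear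
  Representations of Finite Groups*, GTM 42, §2.3, §5.3.  [DixonMortimer1996] J. D. Dixon, B. Mortimer, *Permutation Groups*, GTM 163.  [Lang2002] S. Lang, *Algebra*, GTM 211.
  [MumfordAV1970] D. Mumford, *Abelian Varieties*, §19.
-/

noncomputable section

open CategoryTheory CategoryTheory.Limits NumberField IntermediateField

namespace Summit.HodgeConjecture.CorCM.MultiFieldWeil

open Finset
open Literature.AlgebraicGeometry Literature.AlgebraicGeometry.Motives Literature.AlgebraicGeometry.HodgeTheory
open Literature.AlgebraicGeometry.ComplexMultiplication (IsCMTypeRealisation)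
open Literature.AlgebraicTopology.SingularHomology
open Literature.NumberTheory.ComplexMultiplication

open scoped Classical

section Showcase

variable {K₅ : Type} [f5 : Field K₅] [n5 : NumberField K₅] [c5 : IsCMField K₅] {K₁₀ : Type} [f10 : Field K₁₀] [n10 : NumberField K₁₀] [c10 : IsCMField K₁₀]
  {k : Type} [fk : Field k] [nk : NumberField k] [ck : IsCMField k] {τ : k →+* ℂ}
  {c : ℕ} {T : Fin c → AbelianVariety ℂ} {Ψ₅ : Fin c → CMType K₅} {ιT : ∀ t : Fin c, 𝓞 K₅ →+* End (T t)}
  {θT : ∀ t : Fin c, K₅ →+* Module.End ℂ (complexBetti (T t).X 1)}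
  {c' : ℕ} {D : Fin c' → AbelianVariety ℂ} {Ψ₁₀ : Fin c' → CMType K₁₀} {ιD : ∀ t : Fin c', 𝓞 K₁₀ →+* End (D t)}
  {θD : ∀ t : Fin c', K₁₀ →+* Module.End ℂ (complexBetti (D t).X 1)}
  {E : AbelianVariety ℂ} {Φ₀ : CMType k} {ιE : 𝓞 k →+* End E} {θE : k →+* Module.End ℂ (complexBetti E.X 1)}

/-- **A `2`-TRANSITIVE DECIC FIELD AND A DIHEDRAL DECIC FIELD THROUGH `k`, ONLY `Hom = ∅` BETWEEN THEM — GIVEN ONLY MARKMAN'S THEOREMS.**  See the module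
docstring.  `HC_CM` is NOT asserted. [cite: Markman2025SurveySecant, Thm. 1.2] [cite: Markman2025SecantWeil, Thm 1.5.1] [cite: Shimura1998, §6.1 Corollary of Theorem 2, §18.2]
[cite: Serre1977, §5.3] [cite: DixonMortimer1996, §1.4 Ex. 1.4.1–1.4.2; §1.6, Thm. 1.6A; §3.3] -/
theorem hodgeConjectureFor_biproduct_twoKindsDecic (hW4 : Markman2025_weilClasses_algebraic_abelianFourfold)
    (hM6 : Markman2025_weilClasses_algebraic_hyperbolicSixfold) (h2 : Module.finrank ℚ k = 2) (hE : IsCMTypeRealisation Φ₀ E ιE θE) (hΦ₀ : ∀ σ : k →+* ℂ, σ ∈ Φ₀.1 ↔ σ = τ)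
    (i₅ : k →+* K₅) (h10T : Module.finrank ℚ K₅ = 10)
    (h40 : ∃ s₀ t₀ : K₅ →+* ℂ, s₀.comp i₅ = τ ∧ t₀.comp i₅ = τ ∧ s₀ ≠ t₀ ∧ Module.finrank ℚ ↥(adjoin ℚ (Set.range τ) ⊔ adjoin ℚ (Set.range s₀ ∪ Set.range t₀)) = 40)
    (hc : c ≤ 2) (hT : ∀ t, IsCMTypeRealisation (Ψ₅ t) (T t) (ιT t) (θT t))
    (hcntT : ∀ t, (Finset.univ.filter fun s : K₅ →+* ℂ => s.comp i₅ = τ ∧ s ∈ (Ψ₅ t).1).card = 2) (hniT : ∀ t t', t ≠ t' → ¬ AbelianVariety.IsIsogenous (T t) (T t'))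
    (i₁₀ : k →+* K₁₀) (h10 : Module.finrank ℚ K₁₀ = 10) (hc' : c' ≤ 2) (hD : ∀ t, IsCMTypeRealisation (Ψ₁₀ t) (D t) (ιD t) (θD t))
    (hcntD : ∀ t, (Finset.univ.filter fun s : K₁₀ →+* ℂ => s.comp i₁₀ = τ ∧ s ∈ (Ψ₁₀ t).1).card = 2) (hniD : ∀ t t', t ≠ t' → ¬ AbelianVariety.IsIsogenous (D t) (D t'))
    (h20 : Module.finrank ℚ ↥(normalClosure ℚ K₁₀ ℂ) ≤ 20) (hns : ∃ s₀ t₀ : K₁₀ →+* ℂ, s₀.comp i₁₀ = τ ∧ t₀.comp i₁₀ = τ ∧ ∃ x, t₀ x ∉ adjoin ℚ (Set.range s₀))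
    (hmeetD : ∀ t t' : Fin c', t ≠ t' →
      (Finset.univ.filter fun s : K₁₀ →+* ℂ => s.comp i₁₀ = τ ∧ s ∈ (Ψ₁₀ t).1) ≠ (Finset.univ.filter fun s : K₁₀ →+* ℂ => s.comp i₁₀ = τ ∧ s ∈ (Ψ₁₀ t').1) ∧
      ∃ s : K₁₀ →+* ℂ, s.comp i₁₀ = τ ∧ s ∈ (Ψ₁₀ t).1 ∧ s ∈ (Ψ₁₀ t').1)
    (hiso₁ : IsEmpty (K₅ →+* K₁₀)) (hiso₂ : IsEmpty (K₁₀ →+* K₅))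
    {N : ℕ} (κ : Fin N → Option (Fin c ⊕ Fin c')) :
    HodgeConjectureFor (⨁ fun l => ((κ l).elim E fun x => x.elim T D : AbelianVariety ℂ)).dim (⨁ fun l => ((κ l).elim E fun x => x.elim T D : AbelianVariety ℂ)).X := by
  -- the two fields as a family over `Bool` (`false ↦ K₆`, `true ↦ K₁₀`), instances by the recursor so that they compute on the two constructors
  let KJ : Bool → Type := fun b => @Bool.rec (fun _ => Type) K₅ K₁₀ b
  letI fK : ∀ b, Field (KJ b) := fun b => @Bool.rec (fun b => Field (KJ b)) f5 f10 b
  letI nK : ∀ b, NumberField (KJ b) := fun b => @Bool.rec (fun b => @NumberField (KJ b) (fK b)) n5 n10 b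
  haveI cK : ∀ b, IsCMField (KJ b) := fun b => @Bool.rec (fun b => @IsCMField (KJ b) (fK b) (@NumberField.to_charZero (KJ b) (fK b) (nK b))) c5 c10 b
  let cJ : Bool → ℕ := fun b => @Bool.rec (fun _ => ℕ) c c' b
  let nJ : Bool → ℕ := fun b => @Bool.rec (fun _ => ℕ) 5 5 b
  let iK : ∀ b, k →+* KJ b := fun b => @Bool.rec (fun b => k →+* KJ b) i₅ i₁₀ b
  let BJ : ∀ b, Fin (cJ b) → AbelianVariety ℂ := fun b => @Bool.rec (fun b => Fin (cJ b) → AbelianVariety ℂ) (fun t => T t) (fun t => D t) b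
  let ΨJ : ∀ b, Fin (cJ b) → CMType (KJ b) := fun b => @Bool.rec (fun b => Fin (cJ b) → CMType (KJ b)) (fun t => Ψ₅ t) (fun t => Ψ₁₀ t) b
  let ιJ : ∀ (b : Bool) (t : Fin (cJ b)), 𝓞 (KJ b) →+* End (BJ b t) :=
    fun b => @Bool.rec (fun b => ∀ t : Fin (cJ b), 𝓞 (KJ b) →+* End (BJ b t)) (fun t => ιT t) (fun t => ιD t) b
  let θJ : ∀ (b : Bool) (t : Fin (cJ b)), KJ b →+* Module.End ℂ (complexBetti (BJ b t).X 1) :=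
    fun b => @Bool.rec (fun b => ∀ t : Fin (cJ b), KJ b →+* Module.End ℂ (complexBetti (BJ b t).X 1)) (fun t => θT t) (fun t => θD t) b
  have key := hodgeConjectureFor_biproduct_sigma_allKinds_of_shapes_meet (J := Bool) (KJ := KJ) (c := cJ) (B := BJ) (Ψ := ΨJ) (ιB := ιJ) (θB := θJ) hW4 hM6 h2 iK nJ
    (fun b => by cases b; exacts [h10T, h10]) (fun b => by cases b; exacts [fun t => hT t, fun t => hD t]) hE hΦ₀ (fun _ => False) (fun b => b = true)
    (fun b => by
      cases b
      · exact fun t => Or.inr (Or.inr (Or.inr ⟨rfl, hcntT t⟩))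
      · exact fun t => Or.inr (Or.inr (Or.inr ⟨rfl, hcntD t⟩)))
    (fun b => by
      cases b
      · exact fun t t' h => hniT t t' h
      · exact fun t t' h => hniD t t' h)
    (fun b => by cases b <;> exact fun h => absurd h (by norm_num))
    (fun b => by cases b <;> exact fun h => absurd h (by norm_num))
    (fun b => by cases b <;> exact fun h => absurd h (by norm_num))
    (fun b => by
      cases b
      · exact fun _ => hc.trans (by norm_num)
      · exact fun _ => hc'.trans (by norm_num))
    (fun b => by cases b <;> exact fun h => absurd h (by norm_num))
    (fun b => by
      cases b
      · intro _ h4; exfalso; change c = 4 at h4; omega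
      · intro _ h4; exfalso; change c' = 4 at h4; omega)
    (fun b => by
      cases b
      · intro _ h4; exfalso; change c = 4 at h4; omega
      · intro _ h4; exfalso; change c' = 4 at h4; omega)
    (fun b => by cases b <;> exact fun h => absurd h (by norm_num))
    (fun b => by
      cases b
      · exact fun _ _ _ => h40
      · exact fun _ hnd => absurd rfl hnd)
    (fun b => by
      cases b
      · exact fun hd => absurd hd Bool.false_ne_true
      · exact fun _ => ⟨rfl, hc', h20, hns, fun t t' htt => hmeetD t t' htt⟩)
    (fun b b' hne _ _ => by
      cases b <;> cases b'
      · exact absurd rfl hne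
      · exact hiso₂
      · exact hiso₁
      · exact absurd rfl hne)
    (fun b => by cases b <;> exact fun h => absurd h (by norm_num))
    (fun b b' _ h4' _ _ _ => by
      cases b'
      · exact absurd h4' (by change ¬ ((5 : ℕ) = 4); norm_num)
      · exact absurd h4' (by change ¬ ((5 : ℕ) = 4); norm_num))
    (fun l => (κ l).map fun x => x.elim (fun t => (⟨false, t⟩ : (b : Bool) × Fin (cJ b))) fun t => (⟨true, t⟩ : (b : Bool) × Fin (cJ b)))
  have hfam : (fun l => (((κ l).map fun x => x.elim (fun t => (⟨false, t⟩ : (b : Bool) × Fin (cJ b))) fun t => (⟨true, t⟩ : (b : Bool) × Fin (cJ b))).elim E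
      fun x => BJ x.1 x.2 : AbelianVariety ℂ)) = fun l => ((κ l).elim E fun x => x.elim T D : AbelianVariety ℂ) := by
    funext l
    rcases κ l with _ | t | t <;> rfl
  rw [hfam] at key
  exact key

/-- **Dominated form**: every complex abelian variety dominated by such a product of copies. [cite: Markman2025SurveySecant, Thm. 1.2] [cite: Markman2025SecantWeil, Thm 1.5.1]
[cite: MumfordAV1970, §19] -/
theorem hodgeConjectureFor_of_avDominatedBy_twoKindsDecic (hW4 : Markman2025_weilClasses_algebraic_abelianFourfold)
    (hM6 : Markman2025_weilClasses_algebraic_hyperbolicSixfold) (h2 : Module.finrank ℚ k = 2) (hE : IsCMTypeRealisation Φ₀ E ιE θE) (hΦ₀ : ∀ σ : k →+* ℂ, σ ∈ Φ₀.1 ↔ σ = τ)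
    (i₅ : k →+* K₅) (h10T : Module.finrank ℚ K₅ = 10)
    (h40 : ∃ s₀ t₀ : K₅ →+* ℂ, s₀.comp i₅ = τ ∧ t₀.comp i₅ = τ ∧ s₀ ≠ t₀ ∧ Module.finrank ℚ ↥(adjoin ℚ (Set.range τ) ⊔ adjoin ℚ (Set.range s₀ ∪ Set.range t₀)) = 40)
    (hc : c ≤ 2) (hT : ∀ t, IsCMTypeRealisation (Ψ₅ t) (T t) (ιT t) (θT t))
    (hcntT : ∀ t, (Finset.univ.filter fun s : K₅ →+* ℂ => s.comp i₅ = τ ∧ s ∈ (Ψ₅ t).1).card = 2) (hniT : ∀ t t', t ≠ t' → ¬ AbelianVariety.IsIsogenous (T t) (T t'))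
    (i₁₀ : k →+* K₁₀) (h10 : Module.finrank ℚ K₁₀ = 10) (hc' : c' ≤ 2) (hD : ∀ t, IsCMTypeRealisation (Ψ₁₀ t) (D t) (ιD t) (θD t))
    (hcntD : ∀ t, (Finset.univ.filter fun s : K₁₀ →+* ℂ => s.comp i₁₀ = τ ∧ s ∈ (Ψ₁₀ t).1).card = 2) (hniD : ∀ t t', t ≠ t' → ¬ AbelianVariety.IsIsogenous (D t) (D t'))
    (h20 : Module.finrank ℚ ↥(normalClosure ℚ K₁₀ ℂ) ≤ 20) (hns : ∃ s₀ t₀ : K₁₀ →+* ℂ, s₀.comp i₁₀ = τ ∧ t₀.comp i₁₀ = τ ∧ ∃ x, t₀ x ∉ adjoin ℚ (Set.range s₀))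
    (hmeetD : ∀ t t' : Fin c', t ≠ t' →
      (Finset.univ.filter fun s : K₁₀ →+* ℂ => s.comp i₁₀ = τ ∧ s ∈ (Ψ₁₀ t).1) ≠ (Finset.univ.filter fun s : K₁₀ →+* ℂ => s.comp i₁₀ = τ ∧ s ∈ (Ψ₁₀ t').1) ∧
      ∃ s : K₁₀ →+* ℂ, s.comp i₁₀ = τ ∧ s ∈ (Ψ₁₀ t).1 ∧ s ∈ (Ψ₁₀ t').1)
    (hiso₁ : IsEmpty (K₅ →+* K₁₀)) (hiso₂ : IsEmpty (K₁₀ →+* K₅))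
    {N : ℕ} (κ : Fin N → Option (Fin c ⊕ Fin c')) {X : AbelianVariety ℂ}
    (hX : Domination.AVDominatedBy X (⨁ fun l => ((κ l).elim E fun x => x.elim T D : AbelianVariety ℂ))) : HodgeConjectureFor X.dim X.X :=
  Domination.hodgeConjectureFor_of_avDominatedBy
    (hodgeConjectureFor_biproduct_twoKindsDecic hW4 hM6 h2 hE hΦ₀ i₅ h10T h40 hc hT hcntT hniT i₁₀ h10 hc' hD hcntD hniD h20 hns hmeetD hiso₁ hiso₂ κ) hX

end Showcase

end Summit.HodgeConjecture.CorCM.MultiFieldWeil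

end
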